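import Literature.NumberTheory.DiophantineGeometry.Bcgp2025ModThreeListedImageModular
import Literature.NumberTheory.DiophantineGeometry.AbelianVarietyOrdinaryReduction
import HarnessLib

/-!
# Boxer–Calegari–Gee–Pilloni 2025, Lemma 6.4.3 for the ticked row `3.45.1` (`|Γ′| = 2304`) of
# Table 6.4.4: a mod-`3` image of order `2304` satisfies the four big-image conditions

Topic `Literature/NumberTheory/DiophantineGeometry`, a leaf next to
`Bcgp2025ModThreeListedImageModular.lean` (BCGP 2025 Theorem 9.5.2 in its 15-subgroup form,
`bcgp2025_modThreeListedImage_modular_abelianSurface`).  ONE named fact (D-0014), no proof, no new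
definition, plus one proved repackaging lemma.

That consumer renders hypothesis (1) of Theorem 9.5.2 ("the image of `ρ̄_{A,3}` is one of the
`15` subgroups listed in Lemma 6.4.3") THROUGH the printed Lemma 6.4.3, i.e. as the conjunction of
Whitmore's `GSp₄`-reasonableness (`FramedGaloisRep.IsGSp4Reasonable`), tidiness
(`FramedGaloisRep.IsTidy`), absolute irreducibility of `ρ̄(G_{ℚ(ζ₃)})`, and the two
regular-semisimple clauses.  For a concrete abelian surface these clauses are NOT decidable by a
kernel computation in practice (reasonableness quantifies over all simple submodules of `𝔰𝔭₄^∨`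
and asks for a vanishing `H¹`); in print they are supplied, class by class, by Lemma 6.4.3 with
Table 6.4.4 — a Magma computation (Remark 9.1.5).  This file vendors that printed lemma for the ONE
ticked class that occurs as a non-surjective image on a typical curve of the LMFDB genus-2 list
passing the printed local hypotheses (the venture cell `pub-residmod`,
`run/shared/lean/pub/pub-residmod/lit/LIT2-RESIDUAL-MODULARITY.md` §17: the class of order `2304`,
LMFDB label `3.45.1`, realised by the curve `7889.b.55223.1` of conductor `7³·23`, which is the
printed example of [BCGP25, §10.1]): the row "`3.45.1`, `|Γ′| = 2304`, ✓".

## The printed statements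

**Lemma 6.4.3** (arXiv:2502.20645, label `listofsubgroups`; numbering = arXiv HTML render),
verbatim: "Let `A/ℚ` be an abelian surface with a prime to `3` polarization and good reduction at
`3`, and let `ρ̄ = ρ̄_{A,3} : G_ℚ → GSp₄(𝔽₃)` denote the corresponding mod `3` representation. Then
the following hypotheses: (1) `ρ̄` is `GSp₄`-reasonable in the sense of [Whitmore, Defn. 3.19],
(2) `ρ̄` is tidy in the sense of [BCGP, Defn. 7.5.11], (3) `ρ̄(G_{ℚ(ζ₃)})` contains a regular
semi-simple element, (4) `ρ̄(G_ℚ) ∖ ρ̄(G_{ℚ(ζ₃)})` contains a regular semi-simple element, are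
satisfied precisely if `Γ′ = ρ̄(G_ℚ)` in Table [6.4.4] has a tick".  **Table 6.4.4**, caption
verbatim: "Conjugacy classes of subgroups `Γ′ ⊂ GSp₄(𝔽₃)` with `ν(Γ′) ≠ 1` and
`Γ = Γ′ ∩ Sp₄(𝔽₃)` absolutely irreducible. LMFDB labels determine the conjugacy class of `Γ′` …";
its row for the LMFDB label `3.45.1` reads "`|Γ′| = 2304`" with a TICK (arXiv v1 e-print source,
transcribed in the cell's `lit/BCGP25-Lemma6.4.3-Table6.4.4-source.tex`; one of "the 15 subgroups
listed in Lemma 6.4.3").  **Identification of the class by its order** — [CCG20, Lemma 2],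
verbatim: "The group `G₂₃₀₄` is a semi-direct product `Δ ⋊ ℤ/2ℤ` where
`Δ = {(A, B) ∈ GL₂(𝔽₃)² ∣ det(A) = det(B)}`; it is (up to conjugacy) the unique subgroup of order
`2304` of `GSp₄(𝔽₃)`."  So "`Γ′ = ρ̄(G_ℚ)` is the ticked row `3.45.1`" is rendered, reviewer-checkably
and convention-free, as "`ρ̄(G_ℚ) ≤ GSp(J)(𝔽₃)` has order `2304`" (the dual/`H¹` convention of
[BCGP25, §1.8.2] is immaterial for this class: `−1 ∈ Γ′`, LIT-2 §17.3).  [BCGP25, §10.1] prints the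
instance: "The representation `ρ̄_{A,3}` in this case (with image of order `2304`) is induced from a
representation `ρ̄_{E,3} : G_F → GL₂(𝔽₃)`, where `E` is a modular elliptic curve over
`F = ℚ(√−7)` …" for "the curve of conductor `7³ · 23`", "precisely one of which we can deduce is
modular by Theorem 9.5.2".

## Rendering (clause by clause)

HYPOTHESES, in the consumer's own shapes: `A : AbelianVariety ℚ`, `A.dim = 2`; a torsion frame
`(ρ₀, e)` of `A[3](ℚ̄)` and `ρb = ρ₀^∨` (the paper's `ρ̄_{A,3}` on `H¹`); "a prime to `3`
polarization" by what it is used for (§1.8.23): an invertible alternating `J` with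
`ρb(σ)ᵀ J ρb(σ) = ε̄(σ)⁻¹ J`; "good reduction at `3`": the tree's `HasGoodReductionAt A.X A.dim v`
at the place(s) `v ∣ 3` (implied by the consumer's (3a) `A.HasGoodOrdinaryReductionAt v` via
`HasGoodOrdinaryReductionAt.hasGoodReductionAt`); "`Γ′` is the row `3.45.1`": `Nat.card` of the
image subgroup `ρb.imageOn ⊤ ≤ GL₄(𝔽₃)` is `2304` ([CCG20, Lemma 2]).  CONCLUSION: the five image
clauses of the consumer's hypothesis (1), VERBATIM in its shapes — `ρb.IsGSp4Reasonable J 3`,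
`ρb.IsTidy J`, `IsAbsIrreducible (ρb.imageOn (galCyclotomicPow ℚ 3 1)).subtype` (the caption
condition "`Γ = Γ′ ∩ Sp₄(𝔽₃)` absolutely irreducible", `Γ = ρ̄(G_{ℚ(ζ₃)})` for multiplier `ε̄⁻¹`),
and the two regular-semisimple existence clauses (3), (4).  Neither weaker nor stronger than print:
Lemma 6.4.3 gives (1)–(4) for every ticked row under exactly these hypotheses on `A`, and the
caption gives the absolute irreducibility for every row of the table; we state the single row we
need.  (`End(A_ℚ̄) = ℤ`, the other half of Theorem 9.5.2 (1), is NOT part of Lemma 6.4.3 and is not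
touched here.)

## Status

A finite-group / Magma statement in print ([BCGP25, Remark 9.1.5]: "The computations in this
section and the next are all done using magma, and the explicit code with documentation can be
found at [github.com/fcale75/newabeliansurfacesmagmafiles]"; the reasonableness column also rests
on [Whitmore2022, §4.3 and Table 5]).  Users take
`(h : bcgp2025_lemma643_modThreeImage_order2304)`; a discharge would formalise Lemma 6.4.2 (the
image over `ℚ(ζ_{3^n})` equals the image over `ℚ(ζ₃)` under good reduction at `3`) and the
finite-group facts for `Δ ⋊ ℤ/2` (SIZE L).

## References

* [BoxerCalegariGeePilloni2025] G. Boxer, F. Calegari, T. Gee, V. Pilloni, *Modularity theorems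
  for abelian surfaces*, arXiv:2502.20645 (2025): Lemma 6.4.3 with Table 6.4.4 (row `3.45.1`),
  Lemma 6.4.2, Remark 9.1.5, §1.8.23, §10.1 (the `7³·23` example).
* [CalegariChidambaramGhitza2019] F. Calegari, S. Chidambaram, A. Ghitza, *Some modular abelian
  surfaces*, Math. Comp. 89 (2020) 387–394 = arXiv:1906.10939: Lemma 2 (`G₂₃₀₄`).
* [Whitmore2022] D. Whitmore, *The Taylor–Wiles method for reductive groups*, arXiv:2205.05062:
  Def. 3.19, §4.3, Table 5.
-/

namespace Literature.NumberTheory.DiophantineGeometry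

open CategoryTheory IsDedekindDomain
open scoped NumberField Matrix
open Literature.NumberTheory.GaloisRepresentations Literature.NumberTheory.Automorphic
open Literature.AlgebraicGeometry.Motives (AbelianVariety HasGoodReductionAt)

/-- **Boxer–Calegari–Gee–Pilloni 2025, Lemma 6.4.3 with Table 6.4.4, ticked row `3.45.1`
(`|Γ′| = 2304`).** For every abelian surface `A/ℚ` (`AbelianVariety ℚ`, `dim A = 2`), every torsion
frame `(ρ₀, e)` of `A[3](ℚ̄)` with `ρb = ρ₀^∨` (the paper's `ρ̄_{A,3}`), and every invertible
alternating `J` for which `ρb` is symplectic with multiplier `ε̄⁻¹` ("a prime to `3`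
polarization", §1.8.23): IF `A` has good reduction at (the place above) `3` and the image
`ρ̄_{A,3}(G_ℚ)` has order `2304` — i.e. is the conjugacy class `G₂₃₀₄ = Δ ⋊ ℤ/2`, LMFDB `3.45.1`,
"(up to conjugacy) the unique subgroup of order `2304` of `GSp₄(𝔽₃)`" [CCG20, Lemma 2], a TICKED
row of Table 6.4.4 — THEN the four hypotheses of Lemma 6.4.3 hold: `ρ̄` is `GSp₄`-reasonable
[Whitmore, Def. 3.19] for `J` and `p = 3`, `ρ̄` is tidy [BCGP 2021, Def. 7.5.11], `ρ̄(G_{ℚ(ζ₃)})`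
contains a regular semisimple element, `ρ̄(G_ℚ) ∖ ρ̄(G_{ℚ(ζ₃)})` contains a regular semisimple
element; and (Table 6.4.4, caption) `Γ = ρ̄(G_{ℚ(ζ₃)}) = Γ′ ∩ Sp₄(𝔽₃)` is absolutely irreducible —
stated in exactly the clause shapes of hypothesis (1) of
`bcgp2025_modThreeListedImage_modular_abelianSurface`.  A Magma computation in print (Remark 9.1.5).
Users take `(h : bcgp2025_lemma643_modThreeImage_order2304)`.  Named fact (D-0014), not proved in
the tree.
[cite: BoxerCalegariGeePilloni2025, Lemma 6.4.3 with Table 6.4.4 (row 3.45.1, |Γ′| = 2304, ticked) and its caption; Remark 9.1.5; §1.8.23; §10.1 (the conductor 7³·23 example, "image of order 2304")]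
[cite: CalegariChidambaramGhitza2019, Lemma 2 ("G_2304 … is (up to conjugacy) the unique subgroup of order 2304 of GSp_4(F_3)")]
[cite: Whitmore2022, Def. 3.19; §4.3 and Table 5] -/
def bcgp2025_lemma643_modThreeImage_order2304 : Prop :=
  ∀ (A : AbelianVariety ℚ), A.dim = 2 →
    ∀ (ρ₀ : FramedGaloisRep ℚ (ZMod 3) 4) (e : A.geomTorsion (3 : ℕ) ≃+ (Fin 4 → ZMod 3))
      (ρb : FramedGaloisRep ℚ (ZMod 3) 4),
      (∀ (σ : Field.absoluteGaloisGroup ℚ) (P : A.geomTorsion (3 : ℕ)),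
        e (σ • P) = ((ρ₀ σ : GL (Fin 4) (ZMod 3)) : Matrix (Fin 4) (Fin 4) (ZMod 3)) *ᵥ e P) →
      FramedRep.dual ρ₀ = ρb →
    -- "a prime to `3` polarization" (§1.8.23): `ρ̄_{A,3}` is `GSp(J)`-valued with multiplier `ε̄⁻¹`
    ∀ J : Matrix (Fin 4) (Fin 4) (ZMod 3), Jᵀ = -J → IsUnit J.det →
      (∀ σ : Field.absoluteGaloisGroup ℚ,
        (ρb σ).valᵀ * J * (ρb σ).val =
          (((modPCyclotomicCharacterZMod ℚ 3 σ)⁻¹ : (ZMod 3)ˣ) : ZMod 3) • J) →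
    -- "good reduction at `3`"
    (∀ v : HeightOneSpectrum (𝓞 ℚ), ((3 : ℕ) : 𝓞 ℚ) ∈ v.asIdeal →
      HasGoodReductionAt A.X A.dim v) →
    -- `Γ′ = ρ̄(G_ℚ)` is the ticked row `3.45.1`: the image has order `2304` [CCG20, Lemma 2]
    Nat.card (ρb.imageOn ⊤) = 2304 →
    -- Lemma 6.4.3 (1), (2): `GSp₄`-reasonable [Whitmore 3.19] for `p = 3`, and tidy
    (ρb.IsGSp4Reasonable J 3 ∧ ρb.IsTidy J) ∧
    -- Table 6.4.4 caption: `Γ = ρ̄(G_{ℚ(ζ₃)})` is absolutely irreducible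
    IsAbsIrreducible (ρb.imageOn (galCyclotomicPow ℚ 3 1)).subtype ∧
    -- Lemma 6.4.3 (3): a regular semisimple element in `ρ̄(G_{ℚ(ζ₃)})`
    (∃ g ∈ ρb.imageOn (galCyclotomicPow ℚ 3 1), IsRegularSemisimple g) ∧
    -- Lemma 6.4.3 (4): a regular semisimple element in `ρ̄(G_ℚ) ∖ ρ̄(G_{ℚ(ζ₃)})`
    (∃ g ∈ ρb.imageOn ⊤, g ∉ ρb.imageOn (galCyclotomicPow ℚ 3 1) ∧ IsRegularSemisimple g)

/-- **Repackaging for the consumer.** Under `bcgp2025_lemma643_modThreeImage_order2304`, an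
abelian surface with good reduction at `3`, a prime-to-`3` polarisation (symplectic frame for
`J`) and mod-`3` image of order `2304` satisfies the three image hypotheses of
`bcgp2025_modThreeListedImage_modular_abelianSurface` LITERALLY (its `∃ J, …` conjunct, the
absolute-irreducibility conjunct and the two regular-semisimple conjuncts), so that Theorem 9.5.2
can be applied to it once `End(A_ℚ̄) = ℤ` and the local hypotheses (2), (3a), (3b) are supplied.
Bookkeeping only. [cite: BoxerCalegariGeePilloni2025, Lemma 6.4.3 / Table 6.4.4 row 3.45.1, as consumed by the proof of Theorem 9.5.2 (conditions (5)–(8) of Theorem 9.5.1)] -/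
theorem bcgp2025_listedImageClauses_of_modThreeImage_order2304
    (h : bcgp2025_lemma643_modThreeImage_order2304)
    (A : AbelianVariety ℚ) (hA : A.dim = 2)
    (ρ₀ : FramedGaloisRep ℚ (ZMod 3) 4) (e : A.geomTorsion (3 : ℕ) ≃+ (Fin 4 → ZMod 3))
    (ρb : FramedGaloisRep ℚ (ZMod 3) 4)
    (he : ∀ (σ : Field.absoluteGaloisGroup ℚ) (P : A.geomTorsion (3 : ℕ)),
      e (σ • P) = ((ρ₀ σ : GL (Fin 4) (ZMod 3)) : Matrix (Fin 4) (Fin 4) (ZMod 3)) *ᵥ e P)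
    (hdual : FramedRep.dual ρ₀ = ρb)
    (J : Matrix (Fin 4) (Fin 4) (ZMod 3)) (hJalt : Jᵀ = -J) (hJdet : IsUnit J.det)
    (hsymp : ∀ σ : Field.absoluteGaloisGroup ℚ,
      (ρb σ).valᵀ * J * (ρb σ).val =
        (((modPCyclotomicCharacterZMod ℚ 3 σ)⁻¹ : (ZMod 3)ˣ) : ZMod 3) • J)
    (hgood : ∀ v : HeightOneSpectrum (𝓞 ℚ), ((3 : ℕ) : 𝓞 ℚ) ∈ v.asIdeal →
      HasGoodReductionAt A.X A.dim v)
    (hcard : Nat.card (ρb.imageOn ⊤) = 2304) :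
    (∃ J : Matrix (Fin 4) (Fin 4) (ZMod 3), Jᵀ = -J ∧ IsUnit J.det ∧
      (∀ σ : Field.absoluteGaloisGroup ℚ,
        (ρb σ).valᵀ * J * (ρb σ).val =
          (((modPCyclotomicCharacterZMod ℚ 3 σ)⁻¹ : (ZMod 3)ˣ) : ZMod 3) • J) ∧
      ρb.IsGSp4Reasonable J 3 ∧ ρb.IsTidy J) ∧
    IsAbsIrreducible (ρb.imageOn (galCyclotomicPow ℚ 3 1)).subtype ∧
    (∃ g ∈ ρb.imageOn (galCyclotomicPow ℚ 3 1), IsRegularSemisimple g) ∧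
    (∃ g ∈ ρb.imageOn ⊤, g ∉ ρb.imageOn (galCyclotomicPow ℚ 3 1) ∧ IsRegularSemisimple g) := by
  obtain ⟨⟨hreas, htidy⟩, hirr, h3, h4⟩ :=
    h A hA ρ₀ e ρb he hdual J hJalt hJdet hsymp hgood hcard
  exact ⟨⟨J, hJalt, hJdet, hsymp, hreas, htidy⟩, hirr, h3, h4⟩

/-- The good-reduction hypothesis of the fact is implied by the consumer's (3a) ("`A` has good
ordinary reduction at `3`"): good ordinary reduction is in particular good reduction
(`HasGoodOrdinaryReductionAt.hasGoodReductionAt`). Bookkeeping only. [cite: BoxerCalegariGeePilloni2025, Theorem 9.5.2 (3) and Lemma 6.4.3 (hypothesis "good reduction at 3")] -/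
theorem hasGoodReductionAt_three_of_hasGoodOrdinaryReductionAt (A : AbelianVariety ℚ)
    (h3a : ∀ v : HeightOneSpectrum (𝓞 ℚ), ((3 : ℕ) : 𝓞 ℚ) ∈ v.asIdeal →
      A.HasGoodOrdinaryReductionAt v) :
    ∀ v : HeightOneSpectrum (𝓞 ℚ), ((3 : ℕ) : 𝓞 ℚ) ∈ v.asIdeal →
      HasGoodReductionAt A.X A.dim v :=
  fun v hv => (h3a v hv).hasGoodReductionAt

end Literature.NumberTheory.DiophantineGeometry
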